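import Summits.BirchSwinnertonDyer.BirchSwinnertonDyer.Theorems.Rank1ResidualJetCoreVertexWalkTwoLevel
import Summits.BirchSwinnertonDyer.BirchSwinnertonDyer.Theorems.ClassRecordThreeEulerHalvesAtThreeWalkConductors
import Summits.BirchSwinnertonDyer.BirchSwinnertonDyer.Theorems.ClassRecordThreeEulerHalvesAtThreeWalkStructures
import Summits.BirchSwinnertonDyer.BirchSwinnertonDyer.Theorems.ClassRecordThreeEulerHalvesAtThreeWalkFinite
import Summits.BirchSwinnertonDyer.Rank1Residual.X11b.Three.KolyvaginLine
import HarnessLib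

/-!
# T1 JET (cell `bsd-jet`), road K — STRIKE K5, step 7: [J] Prop. 6.4 ON THE ROW OBJECTS, FULL form,
# TWO-LEVEL bookkeeping — NO hypothesis `m(c) < k`: the kernel `JET.Section6.exists_coreVertex_two`
# instantiated on `H¹(K, E[p^k])` (Selmer modules) and `H¹(K, E[p^{k+s}])` (depth classes)

HONEST FRAMING (programme file §HONESTY, verbatim): «no tranche here proves BSD; ARM L moves the
LITERAL column of an r ≤ 1 census into the kernel-proved-modulo-named-print column.» THEOREMS ONLY
(seat `bsd-jet-pv-1`, session g8; `--supports stmt-BirchSwinnertonDyer-14418`, helper); hypothesis-shaped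
binders (`hdisj`, `hPT`, `hκt` with its level-link clause, `hordκ` and `h47` at level `k + s`) are
discharged in the sequel; 0 classes move; K1 ∕ K3 ∕ K4 stay `@[conjecture]`.

WHAT THIS FILE DOES. `JET.exists_coreVertex_of_orderedFamilies_two` is `JET.exists_coreVertex_of_orderedFamilies`
(p542302) re-run over the TWO-LEVEL abstract walk `JET.Section6.exists_coreVertex_two`
(`Rank1ResidualJetCoreVertexWalkTwoLevel.lean`): the Selmer-module bookkeeping is at level `p^k`, the
depth bookkeeping at level `p^{k+s}` (`s = m(c)` the base depth): data `D` on the conductors admissible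
AT LEVEL `k + s`, `hordκ`/`h47` for the classes `c_{k+s}(P_·)`, and the tilde-class hypothesis `hκt`
carries one extra clause — the LINK «if `ord loc_λ κ̃_{s'} = p^k` at a Kolyvagin `λ` of index `≥ k + s`
then `ord loc_λ c_{k+s}(P_{s'}) = p^{k+s−m(s')}`» (in the sequel: `ι_* κ̃ = p^{s−m(s')} c_{k+s}(P)` and
`ι_*` preserves local orders at such `λ`). CONCLUSION as p542302 but with NO `m(c) < k`: an admissible
multiple `c'` of `c` (new primes of index `≥ k + s`) with `(H_{𝓕(c')})^{−ε(c')} = 0`,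
`(H_{𝓕(c')})^{ε(c')}` cyclic of order `p^k`, `m(c') ≤ m(c)`.
References (locators only; no cited FACT declared): [cite: Jetchev2008, Prop. 6.4 (p. 824) = print
Prop. 5.3 (p. 823); §3.1, Prop. 4.7, Lemma 5.2, Lemma 6.1] [cite: McCallumLMS1991, §3 Cor. 3.2,
§4 Prop. 4.4, Lemma 4.6] [cite: WZhang2014, Notations (xii)]. Design: one theorem, no definitions;
`K : Type`. Axioms: `propext`, `Classical.choice`, `Quot.sound`.
-/

set_option autoImplicit false

noncomputable section

open scoped Classical NumberField

namespace Summit.BirchSwinnertonDyer.Rank1Residual.JET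

open WeierstrassCurve IsDedekindDomain NumberField Literature.NumberTheory.EllipticCurves
  Literature.NumberTheory.EllipticCurves.ModularForms Literature.NumberTheory.EllipticCurves.Jetchev2008
  Literature.NumberTheory.GaloisRepresentations
  Literature.NumberTheory.GaloisRepresentations.DiscreteGaloisModule
  Summit.BirchSwinnertonDyer.Rank1Residual.X11b.Three.Koly

/-- **[J] Prop. 6.4 on the row objects, FULL form, TWO-LEVEL bookkeeping (no `m(c) < k`).** See the
module docstring. [cite: Jetchev2008, Prop. 6.4 (p. 824), §5.2 (p. 821)] [cite: McCallumLMS1991, §3 Cor. 3.2, Lemma 4.6] -/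
theorem exists_coreVertex_of_orderedFamilies_two
    (W : WeierstrassCurve ℚ) [W.IsElliptic] [W.IsGloballyMinimal] [NeZero (W.conductorNorm ℤ)]
    (K : Type) [Field K] [NumberField K] (hK : IsImaginaryQuadratic K)
    (p : ℕ) [Fact p.Prime] (hp2 : p ≠ 2) (hρ : W.HasSurjectiveModNGaloisRep p)
    (Dt : ModularParametrizationData W (W.conductorNorm ℤ)) (β : ℤ) (ι : K →+* ℂ)
    (τ : K ≃ₐ[ℚ] K) (hτ : τ ≠ 1) (k s : ℕ) (hk : 1 ≤ k)
    (𝒯 : SelmerStructure ((W.baseChange K).torsionGaloisModule ((p ^ k : ℕ) : ℤ)))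
    (D : ∀ s' : {m : ℕ // Squarefree m ∧ ∀ q ∈ m.primeFactors,
        Zhang2014.IsKolyvaginPrime (W.conductorNorm ℤ) W K p q ∧ k + s ≤ Zhang2014.kolyvaginIndex W p q},
      KolyvaginHeegnerData Dt β ι s'.1)
    (eb : ℕ → Bool) (heb : ∀ (m ℓ : ℕ), ℓ.Prime → ¬ ℓ ∣ m → eb (m * ℓ) = !eb m)
    (c : ℕ) (hc : Squarefree c ∧ ∀ q ∈ c.primeFactors,
      Zhang2014.IsKolyvaginPrime (W.conductorNorm ℤ) W K p q ∧ k + s ≤ Zhang2014.kolyvaginIndex W p q)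
    (hcs : (if divOrd (D ⟨c, hc⟩) p < Zhang2014.levelIndex W p c then divOrd (D ⟨c, hc⟩) p
      else (⊤ : ℕ∞)) = (s : ℕ∞))
    (hdisj : ∀ (ℓ : ℕ), Zhang2014.IsKolyvaginPrime (W.conductorNorm ℤ) W K p ℓ →
      k ≤ Zhang2014.kolyvaginIndex W p ℓ → ¬ ℓ ∣ c → ∀ v : HeightOneSpectrum (𝓞 K), (ℓ : 𝓞 K) ∈ v.asIdeal →
      Disjoint ((W.baseChange K).kummerSelmerStructure ((p ^ k : ℕ) : ℤ) (Sum.inr v)) (𝒯 (Sum.inr v)))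
    (hPT : ∀ (s' : {m : ℕ // Squarefree m ∧ ∀ q ∈ m.primeFactors,
        Zhang2014.IsKolyvaginPrime (W.conductorNorm ℤ) W K p q ∧ k + s ≤ Zhang2014.kolyvaginIndex W p q})
      (ℓ : ℕ), Zhang2014.IsKolyvaginPrime (W.conductorNorm ℤ) W K p ℓ →
      k + s ≤ Zhang2014.kolyvaginIndex W p ℓ → ¬ ℓ ∣ s'.1 → (∀ q ∈ s'.1.primeFactors, q < ℓ) → c ∣ s'.1 →
      ∀ v : HeightOneSpectrum (𝓞 K), (ℓ : 𝓞 K) ∈ v.asIdeal → ∀ b : Bool,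
      Nat.card ((signPart W K τ ((p ^ k : ℕ) : ℤ) (if b then 1 else -1)
          ((selmerF W ((p ^ k : ℕ) : ℤ) 𝒯 (placesDividing K s'.1)).relaxedAt {v}).selmerGroup).map
        (galoisCohomology.localization ((W.baseChange K).torsionGaloisModule ((p ^ k : ℕ) : ℤ))
          (Sum.inr v) 1)) = p ^ k)
    (hκt : ∀ s', c ∣ s'.1 →
      (if divOrd (D s') p < Zhang2014.levelIndex W p s'.1 then divOrd (D s') p else (⊤ : ℕ∞)) +
        (k : ℕ∞) ≤ Zhang2014.levelIndex W p s'.1 →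
      ∃ x : galoisCohomology ((W.baseChange K).torsionGaloisModule ((p ^ k : ℕ) : ℤ)) 1,
        x ∈ signPart W K τ ((p ^ k : ℕ) : ℤ) (if eb s'.1 then 1 else -1)
          (selmerF W ((p ^ k : ℕ) : ℤ) 𝒯 (placesDividing K s'.1)).selmerGroup ∧
        addOrderOf x = p ^ k ∧
        ((if divOrd (D s') p < Zhang2014.levelIndex W p s'.1 then divOrd (D s') p else (⊤ : ℕ∞)) ≤
            (s : ℕ∞) →
        ∀ (ℓ : ℕ), Zhang2014.IsKolyvaginPrime (W.conductorNorm ℤ) W K p ℓ →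
          k + s ≤ Zhang2014.kolyvaginIndex W p ℓ → ¬ ℓ ∣ s'.1 →
          ∀ v : HeightOneSpectrum (𝓞 K), (ℓ : 𝓞 K) ∈ v.asIdeal →
          addOrderOf (galoisCohomology.localization ((W.baseChange K).torsionGaloisModule ((p ^ k : ℕ) : ℤ))
            (Sum.inr v) 1 x) = p ^ k →
          addOrderOf (galoisCohomology.localization
            ((W.baseChange K).torsionGaloisModule ((p ^ (k + s) : ℕ) : ℤ)) (Sum.inr v) 1
            ((D s').kolyvaginClass (Fact.out : p.Prime) (k + s))) =
            p ^ (k + s - (if divOrd (D s') p < Zhang2014.levelIndex W p s'.1 then divOrd (D s') p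
              else (⊤ : ℕ∞)).toNat)))
    (hordκ : ∀ s' (j : ℕ), j < k + s →
      p ^ (k + s - j) ∣ addOrderOf ((D s').kolyvaginClass (Fact.out : p.Prime) (k + s) :
        galoisCohomology ((W.baseChange K).torsionGaloisModule ((p ^ (k + s) : ℕ) : ℤ)) 1) →
      divOrd (D s') p ≤ (j : ℕ∞))
    (h47 : ∀ (s' s'' : {m : ℕ // Squarefree m ∧ ∀ q ∈ m.primeFactors,
        Zhang2014.IsKolyvaginPrime (W.conductorNorm ℤ) W K p q ∧ k + s ≤ Zhang2014.kolyvaginIndex W p q}) (ℓ : ℕ),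
      ℓ.Prime → ¬ ℓ ∣ s'.1 → s''.1 = s'.1 * ℓ → (∀ q ∈ s'.1.primeFactors, q < ℓ) → c ∣ s'.1 →
      ∀ v : HeightOneSpectrum (𝓞 K), (ℓ : 𝓞 K) ∈ v.asIdeal →
      addOrderOf (galoisCohomology.localization ((W.baseChange K).torsionGaloisModule ((p ^ (k + s) : ℕ) : ℤ))
          (Sum.inr v) 1 ((D s'').kolyvaginClass (Fact.out : p.Prime) (k + s))) =
        addOrderOf (galoisCohomology.localization ((W.baseChange K).torsionGaloisModule ((p ^ (k + s) : ℕ) : ℤ))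
          (Sum.inr v) 1 ((D s').kolyvaginClass (Fact.out : p.Prime) (k + s)))) :
    ∃ s' : {m : ℕ // Squarefree m ∧ ∀ q ∈ m.primeFactors,
        Zhang2014.IsKolyvaginPrime (W.conductorNorm ℤ) W K p q ∧ k + s ≤ Zhang2014.kolyvaginIndex W p q},
      c ∣ s'.1 ∧
      signPart W K τ ((p ^ k : ℕ) : ℤ) (if !eb s'.1 then 1 else -1)
          (selmerF W ((p ^ k : ℕ) : ℤ) 𝒯 (placesDividing K s'.1)).selmerGroup = ⊥ ∧
      IsAddCyclic (signPart W K τ ((p ^ k : ℕ) : ℤ) (if eb s'.1 then 1 else -1)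
          (selmerF W ((p ^ k : ℕ) : ℤ) 𝒯 (placesDividing K s'.1)).selmerGroup) ∧
      Nat.card (signPart W K τ ((p ^ k : ℕ) : ℤ) (if eb s'.1 then 1 else -1)
          (selmerF W ((p ^ k : ℕ) : ℤ) 𝒯 (placesDividing K s'.1)).selmerGroup) = p ^ k ∧
      (if divOrd (D s') p < Zhang2014.levelIndex W p s'.1 then divOrd (D s') p else (⊤ : ℕ∞)) ≤
        (s : ℕ∞) := by
  have hp : p.Prime := Fact.out
  have hc0 : c ≠ 0 := hc.1.ne_zero
  have hcidx : ∀ q ∈ c.primeFactors, k + s ≤ Zhang2014.kolyvaginIndex W p q := fun q hq ↦ (hc.2 q hq).2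
  -- ### the pool of primes `P` and the place `λ(ℓ)`
  let P : Type := {ℓ : ℕ // Zhang2014.IsKolyvaginPrime (W.conductorNorm ℤ) W K p ℓ ∧
    k + s ≤ Zhang2014.kolyvaginIndex W p ℓ ∧ ¬ ℓ ∣ c}
  have hPprime : ∀ ℓ : P, (ℓ : ℕ).Prime := fun ℓ ↦ ℓ.2.1.1
  have hPk : ∀ ℓ : P, k ≤ Zhang2014.kolyvaginIndex W p ℓ := fun ℓ ↦ le_trans (Nat.le_add_right k s) ℓ.2.2.1
  let lam : P → HeightOneSpectrum (𝓞 K) := fun ℓ ↦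
    ⟨Ideal.span {((ℓ : ℕ) : 𝓞 K)}, ℓ.2.1.2.2.2.2.1, by
      rw [Ne, Ideal.span_singleton_eq_bot]
      exact_mod_cast (hPprime ℓ).ne_zero⟩
  have hlam_mem : ∀ ℓ : P, ((ℓ : ℕ) : 𝓞 K) ∈ (lam ℓ).asIdeal := fun ℓ ↦ Ideal.mem_span_singleton_self _
  -- ### the conductors `c·∏ n` (an opaque function with its specification)
  obtain ⟨cond, hcond⟩ : ∃ cond : Finset P → ℕ, ∀ n, cond n = c * ∏ ℓ ∈ n, (ℓ : ℕ) :=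
    ⟨_, fun _ ↦ rfl⟩
  have hcond_empty : cond ∅ = c := by rw [hcond, Finset.prod_empty, mul_one]
  have hcond_insert : ∀ (n : Finset P) (ℓ : P), ℓ ∉ n → cond (insert ℓ n) = cond n * ℓ := by
    intro n ℓ hℓ
    rw [hcond, hcond, Finset.prod_insert hℓ]
    ring
  -- admissibility (at level `k + s`) of every conductor of the walk
  have hadm : ∀ n : Finset P, (Squarefree (cond n) ∧
      ∀ q ∈ (cond n).primeFactors, Zhang2014.IsKolyvaginPrime (W.conductorNorm ℤ) W K p q ∧
        k + s ≤ Zhang2014.kolyvaginIndex W p q) ∧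
      (∀ ℓ : P, ℓ ∉ n → ¬ (ℓ : ℕ) ∣ cond n) := by
    intro n
    obtain ⟨hsq, hfac, hnd⟩ := Walk.squarefree_mul_prod_facts (fun ℓ : P ↦ (ℓ : ℕ))
      Subtype.val_injective hPprime hc.1 (fun ℓ ↦ ℓ.2.2.2) n
    rw [hcond]
    refine ⟨⟨hsq, fun q hq ↦ ?_⟩, hnd⟩
    rw [hfac, Finset.mem_union, Finset.mem_image] at hq
    rcases hq with hq | ⟨ℓ, -, rfl⟩
    · exact ⟨(hc.2 q hq).1, hcidx q hq⟩
    · exact ⟨ℓ.2.1, ℓ.2.2.1⟩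
  -- the admissible conductor of `n`, as a point of the data subtype
  let sadm : Finset P → {m : ℕ // Squarefree m ∧ ∀ q ∈ m.primeFactors,
      Zhang2014.IsKolyvaginPrime (W.conductorNorm ℤ) W K p q ∧ k + s ≤ Zhang2014.kolyvaginIndex W p q} :=
    fun n ↦ ⟨cond n, (hadm n).1⟩
  have hsadm_empty : sadm ∅ = ⟨c, hc⟩ := Subtype.ext hcond_empty
  have hsadm_insert : ∀ (n : Finset P) (ℓ : P), ℓ ∉ n → (sadm (insert ℓ n)).1 = (sadm n).1 * ℓ :=
    fun n ℓ hℓ ↦ hcond_insert n ℓ hℓ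
  have hcond0 : ∀ n : Finset P, cond n ≠ 0 := fun n ↦ (hadm n).1.1.ne_zero
  have hMn : ∀ n : Finset P, (k : ℕ∞) + s ≤ Zhang2014.levelIndex W p (cond n) := fun n ↦ by
    have h := Zhang2014.natCast_le_levelIndex_iff.mpr (fun q hq ↦ ((hadm n).1.2 q hq).2)
    push_cast at h
    exact h
  -- places: `λ ∉ placesDividing (cond n)` for `ℓ ∉ n`, and the insertion rule
  have hlam_not : ∀ (n : Finset P) (ℓ : P), ℓ ∉ n → lam ℓ ∉ placesDividing K (cond n) :=
    fun n ℓ hℓ ↦ Walk.not_mem_placesDividing_of_not_dvd (hPprime ℓ) (hlam_mem ℓ) ((hadm n).2 ℓ hℓ)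
  have hplaces_insert : ∀ (n : Finset P) (ℓ : P), ℓ ∉ n →
      placesDividing K (cond (insert ℓ n)) = insert (lam ℓ) (placesDividing K (cond n)) := by
    intro n ℓ hℓ
    rw [hcond_insert n ℓ hℓ]
    exact Walk.placesDividing_mul_eq_insert (hcond0 n) (hPprime ℓ) ℓ.2.1.2.2.2.2.1 (hlam_mem ℓ)
  -- admissibility «ℓ above every prime factor of the conductor» implies freshness
  have hAdmP : ∀ (n : Finset P) (ℓ : P), (∀ q ∈ (cond n).primeFactors, q < (ℓ : ℕ)) → ℓ ∉ n := by
    intro n ℓ hlt hmem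
    have hfac : (ℓ : ℕ) ∈ (cond n).primeFactors := by
      obtain ⟨_, hfac, _⟩ := Walk.squarefree_mul_prod_facts (fun ℓ : P ↦ (ℓ : ℕ))
        Subtype.val_injective hPprime hc.1 (fun ℓ ↦ ℓ.2.2.2) n
      rw [hcond n, hfac, Finset.mem_union]
      exact Or.inr (Finset.mem_image_of_mem _ hmem)
    exact lt_irrefl _ (hlt _ hfac)
  -- every conductor of the walk is a multiple of `c`
  have hcdvd : ∀ n : Finset P, c ∣ (sadm n).1 := fun n ↦ by
    show c ∣ cond n; rw [hcond]; exact Dvd.intro _ rfl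
  -- finiteness of the relaxed Selmer modules (Kummer structure)
  have hfin := Walk.hfin_of_kummer (K := K) W hp k 𝒯
  -- ### the abstract walk, instantiated
  have key := Section6.exists_coreVertex_two (P := P) (k := k) (s := s) hp hk
    (loc := fun ℓ ↦ galoisCohomology.localization
      ((W.baseChange K).torsionGaloisModule ((p ^ k : ℕ) : ℤ)) (Sum.inr (lam ℓ)) 1)
    (Hf := fun ℓ _ ↦ (W.baseChange K).kummerSelmerStructure ((p ^ k : ℕ) : ℤ) (Sum.inr (lam ℓ)))
    (Htr := fun ℓ _ ↦ 𝒯 (Sum.inr (lam ℓ)))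
    ?hdisj
    (Gs := fun b ↦ signPart W K τ ((p ^ k : ℕ) : ℤ) (if b then 1 else -1) ⊤)
    (Sel := fun n b ↦ signPart W K τ ((p ^ k : ℕ) : ℤ) (if b then 1 else -1)
      (selmerF W ((p ^ k : ℕ) : ℤ) 𝒯 (placesDividing K (cond n))).selmerGroup)
    (Rel := fun n ℓ b ↦ signPart W K τ ((p ^ k : ℕ) : ℤ) (if b then 1 else -1)
      ((selmerF W ((p ^ k : ℕ) : ℤ) 𝒯 (placesDividing K (cond n))).relaxedAt {lam ℓ}).selmerGroup)
    ?hSelGs (Adm := fun n ℓ ↦ ∀ q ∈ (cond n).primeFactors, q < (ℓ : ℕ)) hAdmP ?hfin ?hSel ?hSelT ?hPT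
    (e := fun n ↦ eb (cond n)) ?he ?h61
    (M := fun n ↦ Zhang2014.levelIndex W p (cond n))
    (mdiv := fun n ↦ divOrd (D (sadm n)) p)
    (mc := fun n ↦ if divOrd (D (sadm n)) p < Zhang2014.levelIndex W p (cond n)
      then divOrd (D (sadm n)) p else ⊤)
    ?hm ?hM ?hs
    (κt := fun n ↦ if h : (if divOrd (D (sadm n)) p < Zhang2014.levelIndex W p (cond n)
        then divOrd (D (sadm n)) p else (⊤ : ℕ∞)) + (k : ℕ∞) ≤ Zhang2014.levelIndex W p (cond n)
      then Classical.choose (hκt (sadm n) (hcdvd n) h) else 0)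
    ?hκt
    (loc₂ := fun ℓ ↦ galoisCohomology.localization
      ((W.baseChange K).torsionGaloisModule ((p ^ (k + s) : ℕ) : ℤ)) (Sum.inr (lam ℓ)) 1)
    (κ₂ := fun n ↦ ((D (sadm n)).kolyvaginClass hp (k + s) :
      galoisCohomology ((W.baseChange K).torsionGaloisModule ((p ^ (k + s) : ℕ) : ℤ)) 1))
    ?hordκ ?h47 ?hlink
  · -- read the conclusion at the core vertex `n`
    obtain ⟨n, hcore, hcard, hcyc, hmn⟩ := key
    refine ⟨sadm n, hcdvd n, hcore, hcyc, hcard, ?_⟩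
    rwa [hsadm_empty, hcond_empty, hcs] at hmn
  case hdisj =>
    intro ℓ b
    exact hdisj ℓ ℓ.2.1 (hPk ℓ) ℓ.2.2.2 (lam ℓ) (hlam_mem ℓ)
  case hSelGs =>
    intro n b
    exact Walk.signPart_le_signPart_top W K τ _ _ _
  case hfin =>
    intro n ℓ b _
    haveI := hfin (cond n) (lam ℓ)
    exact Finite.of_injective _ (AddSubgroup.inclusion_injective (inf_le_left
      (a := ((selmerF W ((p ^ k : ℕ) : ℤ) 𝒯 (placesDividing K (cond n))).relaxedAt {lam ℓ}).selmerGroup)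
      (b := (conjActH1 W K τ ((p ^ k : ℕ) : ℤ) - (if b then (1 : ℤ) else -1) •
        AddMonoidHom.id _).ker)))
  case hSel =>
    intro n ℓ b hA
    have hℓ := hAdmP n ℓ hA
    show signPart W K τ _ _ (selmerF W _ 𝒯 (placesDividing K (cond n))).selmerGroup = _
    rw [← Walk.signPart_inf_right]
    congr 1
    exact Walk.selmerGroup_transverseAt_eq_relaxedAt_inf _ 𝒯 (hlam_not n ℓ hℓ)
  case hSelT =>
    intro n ℓ b hA
    have hℓ := hAdmP n ℓ hA
    show signPart W K τ _ _ (selmerF W _ 𝒯 (placesDividing K (cond (insert ℓ n)))).selmerGroup = _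
    rw [hplaces_insert n ℓ hℓ, ← Walk.signPart_inf_right]
    congr 1
    exact Walk.selmerGroup_transverseAt_insert _ 𝒯 _ (lam ℓ)
  case hPT =>
    intro n ℓ b hA
    exact hPT (sadm n) ℓ ℓ.2.1 ℓ.2.2.1 ((hadm n).2 ℓ (hAdmP n ℓ hA)) hA (hcdvd n) (lam ℓ) (hlam_mem ℓ)
      b
  case he =>
    intro n ℓ hA
    have hℓ := hAdmP n ℓ hA
    rw [hcond_insert n ℓ hℓ]
    exact heb (cond n) ℓ (hPprime ℓ) ((hadm n).2 ℓ hℓ)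
  case h61 =>
    intro b x y hx hy hy0 n
    rw [Walk.mem_signPart_top_iff] at hx hy
    have hes : ((if b then (1 : ℤ) else -1) = 1 ∨ (if b then (1 : ℤ) else -1) = -1) := by
      cases b <;> simp
    have hy' : conjAct W τ ((p ^ k : ℕ) : ℤ) y = (-(if b then (1 : ℤ) else -1)) • y := by
      rw [hy]; cases b <;> simp
    obtain ⟨ℓ₀, hbℓ, hZ, hidx, hord⟩ := exists_kolyvaginPrime_addOrderOf_localization_eq_shift W hK hp2 hρ
      τ hτ hk s hes x y hx hy' hy0 (cond n)
    have hcle : c ≤ cond n := by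
      rw [hcond]
      exact Nat.le_mul_of_pos_right _ (Finset.prod_pos fun ℓ _ ↦ (hPprime ℓ).pos)
    have hℓc : ¬ ℓ₀ ∣ c := fun h ↦ by
      have := Nat.le_of_dvd (Nat.pos_of_ne_zero hc0) h
      omega
    refine ⟨⟨ℓ₀, hZ, hidx, hℓc⟩, fun q hq ↦ ?_, hord (lam ⟨ℓ₀, hZ, hidx, hℓc⟩) (hlam_mem _)⟩
    exact lt_of_le_of_lt (Nat.le_of_mem_primeFactors hq) hbℓ
  case hm =>
    intro n h
    rw [if_pos h]
  case hM =>
    intro n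
    rw [hsadm_empty, hcond_empty, hcs]
    exact hMn n
  case hs =>
    rw [hsadm_empty, hcond_empty, hcs]
  case hκt =>
    intro n h
    simp only [dif_pos h]
    exact ⟨(Classical.choose_spec (hκt (sadm n) (hcdvd n) h)).1,
      (Classical.choose_spec (hκt (sadm n) (hcdvd n) h)).2.1⟩
  case hordκ =>
    intro n j hj hdvd
    exact hordκ (sadm n) j hj hdvd
  case h47 =>
    intro n ℓ hA
    have hℓ := hAdmP n ℓ hA
    exact h47 (sadm n) (sadm (insert ℓ n)) ℓ (hPprime ℓ) ((hadm n).2 ℓ hℓ) (hsadm_insert n ℓ hℓ) hA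
      (hcdvd n) (lam ℓ) (hlam_mem ℓ)
  case hlink =>
    intro n ℓ hA hn' hMn' hord
    have hℓ := hAdmP n ℓ hA
    have hns : (if divOrd (D (sadm n)) p < Zhang2014.levelIndex W p (cond n) then divOrd (D (sadm n)) p
        else (⊤ : ℕ∞)) ≤ (s : ℕ∞) := by
      have h := hn'
      rw [hsadm_empty, hcond_empty, hcs] at h
      exact h
    simp only [dif_pos hMn'] at hord
    exact (Classical.choose_spec (hκt (sadm n) (hcdvd n) hMn')).2.2 hns ℓ ℓ.2.1 ℓ.2.2.1 ((hadm n).2 ℓ hℓ)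
      (lam ℓ) (hlam_mem ℓ) hord

end Summit.BirchSwinnertonDyer.Rank1Residual.JET

end
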